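import Summits.Ventures.CertifiedArithmetic.LowPrec.GemmThetaE5M2Sound
import Summits.Ventures.CertifiedArithmetic.LowPrec.GemmThetaE4M3Blocks

/-!
# θ-certificate of E5M2²→bfloat16: image lemma and block structure (soundness, part 2)

HONEST FRAMING (venture CertifiedArithmetic / cell `pub-lowprec`, seat gemm, gen 9): certified error
envelopes and provably optimal rounding/accumulation schemes for low-precision formats under stated
cost models; every table by two implementations; no hardware or vendor claims.

Paper `gemm.tex` §Regimes Prop. Θ(i), instance E5M2·E5M2→`bfloat16`, continued from
`GemmThetaE5M2Sound.lean` (the E5M2² instance of `GemmThetaE4M3Blocks.lean`, whose two generic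
arithmetic lemmas `rneShiftNat_bounds` and `log2_of_binade` are reused): the range of a step and THE
IMAGE LEMMA (`isSt_rne8`, `isSt_WQ`: a rounding within `±2^72` grid units is one of the 16897 signed
states, so the state set is closed under every letter), and the BLOCK STRUCTURE used by the shift
segments of the certificate: inside a binade the states are affine in the index (`valG_add_of_blk`,
`sval_add_sub`) and the potential is affine along each parity class (`psiNat_binade`,
`psiZ_sval_class`).
-/

namespace Literature.ComputerArithmetic.FloatingPoint

namespace MiniFloat

namespace ThetaE5M2

/-! ### The range of a step and the image lemma -/

/-- Every step from a state by a letter lands in `[-2^72, 2^72]` (saturation at the top). [cell] -/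
theorem W_range (σ : Bool) (i : ℕ) {Q : ℤ} (hQ : Q ∈ lamG) :
    -4722366482869645213696 ≤ rne8 (sval σ i + Q) ∧ rne8 (sval σ i + Q) ≤ 4722366482869645213696 := by
  have hV := natAbs_sval_le σ i
  have hq := natAbs_le_of_mem_lamG hQ
  have lo : -4722366482869645213696 - 14123288431433875456 ≤ sval σ i + Q := by omega
  have hi' : sval σ i + Q ≤ 4722366482869645213696 + 14123288431433875456 := by omega
  have m1 := rne8_mono120 (by norm_num) (by omega) lo
  have m2 := rne8_mono120 (by omega) (by norm_num) hi'
  rw [rne8_bot_sub] at m1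
  rw [rne8_top_add] at m2
  exact ⟨m1, m2⟩

/-- THE IMAGE LEMMA: a rounding `rne8 X` within `[-2^72, 2^72]` has the magnitude of a state —
8 significant bits in a binade `≤ 64`, or the top. [cell] -/
theorem exists_idx_of_rne8 {X : ℤ} (h1 : -4722366482869645213696 ≤ rne8 X)
    (h2 : rne8 X ≤ 4722366482869645213696) :
    ∃ j : ℕ, j ≤ 8448 ∧ valG j = (rne8 X).natAbs := by
  have hmag : (rne8 X).natAbs = rne8Mag X.natAbs := by unfold rne8; split_ifs <;> simp
  have hM : rne8Mag X.natAbs ≤ 4722366482869645213696 := by rw [← hmag]; omega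
  rw [hmag]
  generalize X.natAbs = n at hM ⊢
  have h8448 : valG 8448 = 4722366482869645213696 := by decide
  unfold rne8Mag at hM ⊢
  by_cases hn : n < 256
  · rw [if_pos hn] at hM ⊢
    exact ⟨n, by omega, by unfold valG; rw [if_pos hn]⟩
  · rw [if_neg hn] at hM ⊢
    obtain ⟨hlo, hhi⟩ := log2_binade (not_lt.mp hn)
    generalize Nat.log2 n - 7 = e at hlo hhi hM ⊢
    obtain ⟨b1, b2⟩ := ThetaE4M3.rneShiftNat_bounds n e
    generalize rneShiftNat n e = m at b1 b2 hM ⊢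
    have hpos : 0 < 2 ^ e := by positivity
    have hq1 : 128 ≤ n / 2 ^ e := by
      rw [Nat.le_div_iff_mul_le hpos]
      rw [pow_add] at hlo; norm_num at hlo; omega
    have hq2 : n / 2 ^ e < 256 := by
      rw [Nat.div_lt_iff_lt_mul hpos]
      rw [pow_add, pow_add] at hhi; norm_num at hhi; omega
    have he1 : 1 ≤ e := by
      by_contra h0
      have : e = 0 := by omega
      subst this; norm_num at hhi; omega
    have hm1 : 128 ≤ m := by omega
    generalize hP : m * 2 ^ e = P at hM ⊢
    by_cases he64 : e ≤ 64
    · by_cases hm256 : m = 256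
      · subst hm256
        by_cases he63 : e ≤ 63
        · refine ⟨256 + 128 * e, by omega, ?_⟩
          unfold valG
          rw [if_neg (by omega), if_pos (by omega), show 256 + 128 * e - 256 = 0 + 128 * e by omega,
            Nat.add_mul_mod_self_left, Nat.add_mul_div_left _ _ (by norm_num : 0 < 128), ← hP]
          norm_num; rw [pow_succ]; ring
        · have he : e = 64 := by omega
          subst he; refine ⟨8448, le_rfl, ?_⟩; rw [h8448, ← hP]; norm_num
      · have hm2 : m - 128 < 128 := by omega
        refine ⟨256 + 128 * (e - 1) + (m - 128), by omega, ?_⟩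
        unfold valG
        rw [if_neg (by omega), if_pos (by omega),
          show 256 + 128 * (e - 1) + (m - 128) - 256 = (m - 128) + 128 * (e - 1) by omega,
          Nat.add_mul_mod_self_left, Nat.add_mul_div_left _ _ (by norm_num : 0 < 128),
          Nat.mod_eq_of_lt hm2, Nat.div_eq_of_lt hm2, ← hP,
          show 128 + (m - 128) = m by omega, show 0 + (e - 1) + 1 = e by omega]
    · -- binade 65 and above: only the top value fits
      have h65 : 2 ^ 65 ≤ 2 ^ e := Nat.pow_le_pow_right (by norm_num) (by omega)
      have hge : 128 * 2 ^ 65 ≤ P := by rw [← hP]; exact Nat.mul_le_mul hm1 h65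
      refine ⟨8448, le_rfl, ?_⟩
      rw [h8448]; norm_num at hge ⊢; omega

/-- A rounding within `[-2^72, 2^72]` is a signed state. [cell] -/
theorem isSt_rne8 {X : ℤ} (h1 : -4722366482869645213696 ≤ rne8 X) (h2 : rne8 X ≤ 4722366482869645213696) :
    IsSt (rne8 X) := by
  obtain ⟨j, hj, hv⟩ := exists_idx_of_rne8 h1 h2
  refine ⟨decide (rne8 X < 0), j, hj, ?_⟩
  unfold sval; rw [hv]
  by_cases hW : rne8 X < 0
  · simp only [hW, decide_true, if_true]; omega
  · simp only [hW, decide_false, Bool.false_eq_true, if_false]; omega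

/-- CLOSURE: every step from a state by a letter is a state. [cell certificate] -/
theorem isSt_WQ {Q : ℤ} (hQ : Q ∈ lamG) (σ : Bool) (i : ℕ) : IsSt (WQ σ i Q) :=
  isSt_rne8 (W_range σ i hQ).1 (W_range σ i hQ).2

/-! ### Blocks: the states are affine inside a block, the potential affine along parity classes -/

/-- `blk` is monotone, and an index of block `≤ 64` is below the top. [cell] -/
theorem blk_mono_lt_top {i j : ℕ} (h : i ≤ j) : blk i ≤ blk j ∧ (blk j ≤ 64 → j < 8448) := by
  unfold blk; split_ifs <;> omega

/-- Blocks are intervals. [cell] -/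
theorem blk_sandwich {i j l : ℕ} (h : blk i = blk l) (hij : i ≤ j) (hjl : j ≤ l) : blk j = blk i :=
  le_antisymm (h ▸ (blk_mono_lt_top hjl).1) (blk_mono_lt_top hij).1

/-- One index step inside a block adds `bstep`. [cell] -/
theorem valG_succ_of_blk {i : ℕ} (h : blk i = blk (i + 1)) (hk : blk i ≤ 64) :
    valG (i + 1) = valG i + bstep (blk i) := by
  have hi1 : i + 1 < 8448 := (blk_mono_lt_top le_rfl).2 (h ▸ hk)
  have hi : i < 8448 := by omega
  by_cases h256 : i + 1 < 256
  · have hi256 : i < 256 := by omega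
    have hb : blk i = 0 := by unfold blk; rw [if_pos hi256]
    rw [hb]; unfold valG bstep; rw [if_pos h256, if_pos hi256, if_pos rfl]
  · have hi256 : ¬ i < 256 := by
      intro hc
      unfold blk at h; rw [if_pos hc, if_neg h256, if_pos hi1] at h; omega
    have hb : blk i = (i - 256) / 128 + 1 := by unfold blk; rw [if_neg hi256, if_pos hi]
    have hb' : blk (i + 1) = (i + 1 - 256) / 128 + 1 := by unfold blk; rw [if_neg h256, if_pos hi1]
    have hd : (i + 1 - 256) / 128 = (i - 256) / 128 := by rw [hb, hb'] at h; omega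
    have hm : (i + 1 - 256) % 128 = (i - 256) % 128 + 1 := by omega
    rw [hb]; unfold valG bstep
    rw [if_neg h256, if_pos hi1, if_neg hi256, if_pos hi,
      if_neg (show ¬ (i - 256) / 128 + 1 = 0 by omega), hd, hm]
    ring

/-- `n` index steps inside a block add `n · bstep`. [cell] -/
theorem valG_add_of_blk {i : ℕ} (hk : blk i ≤ 64) :
    ∀ n : ℕ, blk i = blk (i + n) → valG (i + n) = valG i + n * bstep (blk i)
  | 0, _ => by simp
  | n + 1, h => by
      have hn : blk (i + n) = blk i := blk_sandwich h (Nat.le_add_right i n) (by omega)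
      have h1 : blk (i + n) = blk (i + n + 1) := by rw [hn, h, Nat.add_assoc]
      rw [← Nat.add_assoc, valG_succ_of_blk h1 (hn ▸ hk), valG_add_of_blk hk n hn.symm, hn]; ring

/-- Parallel classes have a constant value offset: `V(j+n) - V(i+n) = V(j) - V(i)` inside one block.
[cell] -/
theorem sval_add_sub (σ : Bool) {i j n : ℕ} (hi : blk i = blk (i + n)) (hj : blk j = blk (j + n))
    (hij : blk i = blk j) (hk : blk i ≤ 64) :
    sval σ (j + n) - sval σ (i + n) = sval σ j - sval σ i := by
  have e1 := valG_add_of_blk hk n hi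
  have e2 := valG_add_of_blk (hij ▸ hk) n hj
  rw [← hij] at e2
  cases σ
  · rw [(sval_cases (j + n)).1, (sval_cases (i + n)).1, (sval_cases j).1, (sval_cases i).1, e1, e2]
    push_cast; ring
  · rw [(sval_cases (j + n)).2, (sval_cases (i + n)).2, (sval_cases j).2, (sval_cases i).2, e1, e2]
    push_cast; ring

/-- THE CLOSED FORM on a binade state `(128 + t)·2^k`. [cell] -/
theorem psiNat_binade (t k : ℕ) (ht : t < 128) (hk1 : 1 ≤ k) (hk : k ≤ 64) :
    psiNat ((128 + t) * 2 ^ k) = psiBase.getD (k - 1) 0 + psiOdd.getD (k - 1) 0 * (((t + 1) / 2 : ℕ) : ℤ)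
      + psiEven.getD (k - 1) 0 * ((t / 2 : ℕ) : ℤ) := by
  have hpos : 0 < 2 ^ k := by positivity
  have h2k : 2 ≤ 2 ^ k := by
    calc 2 = 2 ^ 1 := by norm_num
      _ ≤ 2 ^ k := Nat.pow_le_pow_right (by norm_num) hk1
  have hlo : 2 ^ (k + 7) ≤ (128 + t) * 2 ^ k := by
    rw [pow_add, mul_comm]; exact Nat.mul_le_mul_right _ (show 2 ^ 7 ≤ 128 + t by norm_num)
  have hhi : (128 + t) * 2 ^ k < 2 ^ (k + 7 + 1) := by
    rw [pow_add, pow_add, show 2 ^ k * 2 ^ 7 * 2 ^ 1 = 256 * 2 ^ k by ring]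
    exact Nat.mul_lt_mul_of_pos_right (by omega) hpos
  have hlog : Nat.log2 ((128 + t) * 2 ^ k) = k + 7 := ThetaE4M3.log2_of_binade hlo hhi
  have h256 : ¬ (128 + t) * 2 ^ k < 256 := by
    have := Nat.mul_le_mul (show 128 ≤ 128 + t by omega) h2k; omega
  have htop : (128 + t) * 2 ^ k ≠ 4722366482869645213696 := by
    have h64 : 2 ^ k ≤ 2 ^ 64 := Nat.pow_le_pow_right (by norm_num) hk
    have := Nat.mul_le_mul (show 128 + t ≤ 255 by omega) h64
    norm_num at this; omega
  unfold psiNat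
  rw [if_neg h256, if_neg htop]
  simp only [hlog, show k + 7 - 7 = k by omega, Nat.mul_div_cancel _ hpos, show 128 + t - 128 = t by omega]

/-- The closed form at a binade index. [cell] -/
theorem psiNat_valG {i : ℕ} (h1 : 256 ≤ i) (h2 : i < 8448) :
    psiNat (valG i) = psiBase.getD (blk i - 1) 0
      + psiOdd.getD (blk i - 1) 0 * ((((i - 256) % 128 + 1) / 2 : ℕ) : ℤ)
      + psiEven.getD (blk i - 1) 0 * (((i - 256) % 128 / 2 : ℕ) : ℤ) := by
  have hv : valG i = (128 + (i - 256) % 128) * 2 ^ blk i := by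
    unfold valG blk; rw [if_neg (by omega), if_pos h2, if_neg (by omega), if_pos h2]
  have hb : blk i = (i - 256) / 128 + 1 := by unfold blk; rw [if_neg (by omega), if_pos h2]
  rw [hv]
  exact psiNat_binade _ _ (Nat.mod_lt _ (by norm_num)) (by rw [hb]; omega) (by rw [hb]; omega)

/-- Two index steps inside a block add `dpsi` to the potential. [cell] -/
theorem psiZ_sval_add_two (σ : Bool) {i : ℕ} (h : blk i = blk (i + 2)) (hk : blk i ≤ 64) :
    psiZ (sval σ (i + 2)) = psiZ (sval σ i) + dpsi σ (blk i) := by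
  have hi2 : i + 2 < 8448 := (blk_mono_lt_top le_rfl).2 (h ▸ hk)
  cases σ
  · rw [(psiZ_sval_cases (i + 2)).1, (psiZ_sval_cases i).1]
    unfold dpsi
    simp only [Bool.false_eq_true, if_false]
    by_cases hk0 : blk i = 0
    · have hi : i + 2 < 256 := by
        by_contra hc
        have h0 : blk (i + 2) = 0 := by rw [← h]; exact hk0
        unfold blk at h0
        rw [if_neg hc] at h0
        by_cases h' : i + 2 < 8448
        · rw [if_pos h'] at h0; omega
        · rw [if_neg h'] at h0; omega
      rw [if_pos hk0]
      unfold valG psiNat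
      rw [if_pos (by omega : i < 256), if_pos hi, if_pos hi, if_pos (by omega : i < 256)]
      push_cast; ring
    · rw [if_neg hk0]
      have h256 : 256 ≤ i := by
        unfold blk at hk0; split_ifs at hk0 <;> omega
      rw [psiNat_valG h256 (by omega), psiNat_valG (by omega) hi2, ← h]
      have hm : (i + 2 - 256) % 128 = (i - 256) % 128 + 2 := by
        unfold blk at h
        rw [if_neg (by omega), if_pos (by omega), if_neg (by omega), if_pos hi2] at h
        omega
      have e1 : ((i - 256) % 128 + 2 + 1) / 2 = ((i - 256) % 128 + 1) / 2 + 1 := by omega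
      have e2 : ((i - 256) % 128 + 2) / 2 = (i - 256) % 128 / 2 + 1 := by omega
      rw [hm, e1, e2]; push_cast; ring
  · rw [(psiZ_sval_cases (i + 2)).2, (psiZ_sval_cases i).2, valG_add_of_blk hk 2 h]
    unfold dpsi
    simp only [if_true]
    push_cast; ring

/-- THE CLASS LEMMA: along a parity class inside one block the potential is affine,
`Φ(V(i + 2m)) = Φ(V(i)) + m · dpsi`. [cell] -/
theorem psiZ_sval_class (σ : Bool) {i : ℕ} (hk : blk i ≤ 64) :
    ∀ m : ℕ, blk i = blk (i + 2 * m) →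
      psiZ (sval σ (i + 2 * m)) = psiZ (sval σ i) + (m : ℤ) * dpsi σ (blk i)
  | 0, _ => by simp
  | m + 1, h => by
      rw [show i + 2 * (m + 1) = i + 2 * m + 2 by ring] at h ⊢
      have hn : blk (i + 2 * m) = blk i := blk_sandwich h (by omega) (by omega)
      have h2 : blk (i + 2 * m) = blk (i + 2 * m + 2) := by rw [hn, h]
      rw [psiZ_sval_add_two σ h2 (hn ▸ hk), psiZ_sval_class σ hk m hn.symm, hn]
      push_cast; ring

end ThetaE5M2

end MiniFloat

end Literature.ComputerArithmetic.FloatingPoint
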